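import Mathlib
import HarnessLib
import Summits.AtomisticToContinuum.FouriersLaw.Theses.CoercivePulse
import Summits.AtomisticToContinuum.FouriersLaw.Theses.CageBudgetFekete
import Summits.AtomisticToContinuum.FouriersLaw.Theorems.CoercivePulseConductanceLowerBoundOfLinearSpread

/-!
# Crux `AbelThermodynamicLimit` (stmt-AtomisticToContinuum-12596), shared by four routes: on CoercivePulse and CageBudgetFekete the
# node closes from the route's own cruxes and the ONE child (R) = `UniformAbelianRegularity` (stmt-13416)

Support file (`--supports stmt-AtomisticToContinuum-12596`; closes nothing).  Lead seat 12596-c22, 2026-08-17.  Companion of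
`Theorems/HoelderEscapeProfileAbelThermodynamicLimitOfEngine.lean` (the same statement for the bet route HoelderEscapeProfile).

The gen-1 split of the crux is {(R) = stmt-13416, CLB = stmt-11749} with landed glue `(R) → CLB → crux`.  The child CLB is supplied
IN TREE by each sharing route's own items together with (R): CageBudgetFekete (`conductanceLowerBound_of_heatVarianceBets`, crux-strategist
s2, p156938) and CoercivePulse (`conductanceLowerBound_of_linearSpread`, p157637).  Hence:

* `abelThermodynamicLimit_of_pulseEngine_and_regularity` / `fouriersLaw_of_pulseEngine_and_regularity` — on CoercivePulse the crux,
  and `FouriersLaw` through the route's `closes`, follow from `LinearSpread`, `LinearCeiling`, `AbelRegularity`, `PulseCalculus`,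
  `SymmetricSetup` and (R) alone;
* `abelThermodynamicLimit_of_cageEngine_and_regularity` / `fouriersLaw_of_cageEngine_and_regularity` — on CageBudgetFekete the crux,
  and `FouriersLaw`, follow from `SymmetricSetup`, `HeatVarianceCalculus`, `QuasiSuperadditiveHeatVariance`, `HeatVarianceCeiling`
  (for `closes` only), `UnboundedHeatVariance` and (R) alone.

So on three of the four sharing routes (these two and HoelderEscapeProfile) the honest open cone under this node is {stmt-13416}; only
EmbeddedDrudeMourre (γ-blind, non-shift-invariant witness; no positivity item) keeps the cone {stmt-13416, stmt-11749}.
No definitions, no named facts, no sorry.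
-/

noncomputable section

namespace Summit.AtomisticToContinuum.FouriersLaw.Theorems.AbelThermodynamicLimit.SharedCone

/-- **CoercivePulse: the crux from the pulse engine and (R)** — split glue (p127832, as the route's `AbelThermodynamicLimitGlueBy_holds`)
applied to (R) and `conductanceLowerBound_of_linearSpread` (p157637). [folklore] -/
theorem abelThermodynamicLimit_of_pulseEngine_and_regularity : Summit.AtomisticToContinuum.FouriersLaw.Theses.CoercivePulse.SymmetricSetup → Summit.AtomisticToContinuum.FouriersLaw.Theses.CoercivePulse.PulseCalculus → Summit.AtomisticToContinuum.FouriersLaw.Theses.CoercivePulse.LinearSpread → Summit.AtomisticToContinuum.FouriersLaw.Theses.CoercivePulse.UniformAbelianRegularity → Summit.AtomisticToContinuum.FouriersLaw.Theses.CoercivePulse.AbelThermodynamicLimit :=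
  fun hSet hPC hLS hR =>
  Summit.AtomisticToContinuum.FouriersLaw.Theses.CoercivePulse.AbelThermodynamicLimitGlueBy_holds hR
    (Summit.AtomisticToContinuum.FouriersLaw.Cruxes.ConductanceLowerBound.AbelFloorExchange.conductanceLowerBound_of_linearSpread
      hSet hPC hLS hR)

/-- **CoercivePulse: `FouriersLaw` from the route's five own cruxes and (R)** (through the route's deciding theorem `closes`): the
shared node `AbelThermodynamicLimit` and its child CLB are dispensable on this route given (R). [cite: BonettoLebowitzReyBellet2000, §5.3 eq. (33)] -/
theorem fouriersLaw_of_pulseEngine_and_regularity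
    (hLS : Summit.AtomisticToContinuum.FouriersLaw.Theses.CoercivePulse.LinearSpread)
    (hLC : Summit.AtomisticToContinuum.FouriersLaw.Theses.CoercivePulse.LinearCeiling)
    (hAR : Summit.AtomisticToContinuum.FouriersLaw.Theses.CoercivePulse.AbelRegularity)
    (hPC : Summit.AtomisticToContinuum.FouriersLaw.Theses.CoercivePulse.PulseCalculus)
    (hSet : Summit.AtomisticToContinuum.FouriersLaw.Theses.CoercivePulse.SymmetricSetup)
    (hR : Summit.AtomisticToContinuum.FouriersLaw.Theses.CoercivePulse.UniformAbelianRegularity) : _root_.FouriersLaw :=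
  Summit.AtomisticToContinuum.FouriersLaw.Theses.CoercivePulse.closes hLS hLC hAR
    (abelThermodynamicLimit_of_pulseEngine_and_regularity hSet hPC hLS hR) hPC hSet

/-- **CageBudgetFekete: the crux from the heat-variance bets and (R)** — split glue applied to (R) and crux-strategist s2's
`conductanceLowerBound_of_heatVarianceBets` (p156938). [folklore] -/
theorem abelThermodynamicLimit_of_cageEngine_and_regularity
    (hSet : Summit.AtomisticToContinuum.FouriersLaw.Theses.CageBudgetFekete.SymmetricSetup)
    (hHC : Summit.AtomisticToContinuum.FouriersLaw.Theses.CageBudgetFekete.HeatVarianceCalculus)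
    (hQ : Summit.AtomisticToContinuum.FouriersLaw.Theses.CageBudgetFekete.QuasiSuperadditiveHeatVariance)
    (hU : Summit.AtomisticToContinuum.FouriersLaw.Theses.CageBudgetFekete.UnboundedHeatVariance)
    (hR : Summit.AtomisticToContinuum.FouriersLaw.Theses.CageBudgetFekete.UniformAbelianRegularity) :
    Summit.AtomisticToContinuum.FouriersLaw.Theses.CageBudgetFekete.AbelThermodynamicLimit :=
  Summit.AtomisticToContinuum.FouriersLaw.Theses.CageBudgetFekete.AbelThermodynamicLimitGlueBy_holds hR
    (Summit.AtomisticToContinuum.FouriersLaw.Cruxes.ConductanceLowerBound.AbelFloorExchange.conductanceLowerBound_of_heatVarianceBets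
      hSet hHC hQ hU hR)

/-- **CageBudgetFekete: `FouriersLaw` from the route's five own cruxes and (R)** (through the route's `closes`; crux-strategist s2's
reading F1, here as a landed theorem). [cite: BonettoLebowitzReyBellet2000, §5.3 eq. (33)] -/
theorem fouriersLaw_of_cageEngine_and_regularity
    (hSet : Summit.AtomisticToContinuum.FouriersLaw.Theses.CageBudgetFekete.SymmetricSetup)
    (hHC : Summit.AtomisticToContinuum.FouriersLaw.Theses.CageBudgetFekete.HeatVarianceCalculus)
    (hQ : Summit.AtomisticToContinuum.FouriersLaw.Theses.CageBudgetFekete.QuasiSuperadditiveHeatVariance)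
    (hCeil : Summit.AtomisticToContinuum.FouriersLaw.Theses.CageBudgetFekete.HeatVarianceCeiling)
    (hU : Summit.AtomisticToContinuum.FouriersLaw.Theses.CageBudgetFekete.UnboundedHeatVariance)
    (hR : Summit.AtomisticToContinuum.FouriersLaw.Theses.CageBudgetFekete.UniformAbelianRegularity) : _root_.FouriersLaw :=
  Summit.AtomisticToContinuum.FouriersLaw.Theses.CageBudgetFekete.closes hSet hHC hQ hCeil hU
    (abelThermodynamicLimit_of_cageEngine_and_regularity hSet hHC hQ hU hR)

end Summit.AtomisticToContinuum.FouriersLaw.Theorems.AbelThermodynamicLimit.SharedCone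

end
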